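import Mathlib
import HarnessLib
import Summits.HodgeConjecture.HodgeConjecture.Theses.KleimanBFSeeds
import Summits.HodgeConjecture.HodgeConjecture.Theorems.KleimanBFSeedsKleimanSemiregularAnchorReductions
import Literature.AlgebraicGeometry.HodgeTheory.WeilClassesBFSheafSeedAt
import Literature.AlgebraicGeometry.HodgeTheory.ChernCharacterBettiRescale

/-!
# K2 for ALL Chern character theories from K2 for ONE theory, under uniqueness up to scaling on the anchors

HONEST FRAMING: HELPER lemmas for the crux `KleimanSemiregularAnchor` (K2, stmt-HodgeConjecture-25931, route
`KleimanBFSeeds`, registered stub `stub_good : GoodAnchorPerDiscriminantClass`); NOTHING here constructs a semiregular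
sheaf, and nothing proves K2, rung H2, HC_AV, HC_CM or HC.

WHY. The crux quantifies over EVERY inhabitant `C` of the hypothesis structure `ChernCharacterBetti`, whose fields pin the
Chern character of a specific sheaf only up to the residual freedom recorded in `HodgeTheory/ChernCharacterBetti`
(rescaling `chᵢ ↦ λⁱ·chᵢ`, `ChernCharacterBetti.rescale`; uniqueness up to that rescaling is NOT a theorem of the tree).
Consequently a semiregular sheaf taken from the literature, whose Chern character is computed for THE Chern character,
does not by itself give the `C`-seed `HasBFSheafSeedAt C 3 P h w` for an abstract `C`. This file isolates exactly what
closes that gap: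

* §1 TRANSFER ALONG A SCALING RELATION at one anchor `P`: if `C.chᵢ(E) = tⁱ·C₀.chᵢ(E)` (`t ∈ ℚˣ`) for every finite
  locally free `E` on `P.X`, then `C`-designs are `C₀`-designs (`hasWeilClassDesignAt_of_scaling`), `C₀`-seeds are
  `C`-seeds (`hasBFSheafSeedAt_of_scaling`), hence the K2 upgrade `HasWeilClassDesignAt → HasBFSheafSeedAt` at
  `(P, h, w)` for `C₀` gives the one for `C` (`upgrade_of_scaling`). (One model suffices, §1 of
  `KleimanBFSeedsKleimanSemiregularAnchorReductions`.)
* §2 SANITY: the relation holds for `(C.rescale t, C)`, so the K2 predicates are invariant under the known freedom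
  (`upgrade_rescale_iff`).
* §3 **K2 ⇐ (U) + K2(C₀)**: if some theory `C₀` has one good anchor per discriminant class (the hypothesis of the landed
  `kleimanSemiregularAnchor_of_goodAnchor_in_each_discriminantClass`, for `C₀` ONLY) and every theory `C` agrees with `C₀`
  up to scaling on the finite locally free modules of each Weil sixfold anchor — hypothesis (U), uniqueness of the Chern
  character up to `λⁱ` (in reality a consequence of the fields via the splitting principle, Grothendieck 1958; not in
  the tree) — then `KleimanSemiregularAnchor` (`kleimanSemiregularAnchor_of_goodAnchors_for_one_theory`).

So the ∀-`C` crux splits into: (U) [library, about the hypothesis structure] and K2 for ONE theory [the deformation-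
theoretic core: one `I ∋ 3`-semiregular finite locally free sheaf of seed shape per discriminant class].

References: [Fulton1998] Example 3.2.3, §15.1; [Grothendieck1958] Thm. 1 (axiomatic uniqueness of Chern classes);
[BuchweitzFlenner2003] §5 (I-semiregular); [vanGeemen1994HodgeAV] Lemma 5.2, 5.3–5.4.
-/

-- every declaration of this problem lives in `Summit.HodgeConjecture.HodgeConjecture.…` (summit = sub-problem)
set_option linter.dupNamespace false

noncomputable section

open CategoryTheory AlgebraicGeometry

namespace Summit.HodgeConjecture.HodgeConjecture.Theorems

open Literature.AlgebraicGeometry Literature.AlgebraicGeometry.Motives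
open Literature.AlgebraicGeometry.HodgeTheory
open Literature.AlgebraicGeometry.VanGeemen1994
open Literature.AlgebraicTopology.SingularHomology
open Summit.HodgeConjecture.HodgeConjecture.Ring2.AbelianAll

/-! ### §1 Transfer of designs, seeds and the K2 upgrade along a scaling relation at one anchor -/

section Scaling

variable {C C₀ : ChernCharacterBetti} {n : ℕ} {P : AbelianVariety ℂ} {h : complexBetti P.X 2}
  {w : complexBetti P.X (2 * n)} {t : ℚ}

/-- **`C`-designs are `C₀`-designs** when `C.chᵢ = tⁱ·C₀.chᵢ` (`t ≠ 0`) on the finite locally free modules of `P.X`: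
divide the coefficients by `tⁱ`. [cite: Fulton1998, Example 3.2.3 and Example 15.3.2] -/
theorem hasWeilClassDesignAt_of_scaling (ht : t ≠ 0)
    (hCC₀ : ∀ (E : P.X.left.Modules), IsFiniteLocallyFree E → ∀ i : ℕ,
      C.ch P.X E i = ((t ^ i : ℚ) : ℂ) • C₀.ch P.X E i)
    (hD : HasWeilClassDesignAt C n P h w) : HasWeilClassDesignAt C₀ n P h w := by
  rw [hasWeilClassDesignAt_iff_exists_on] at hD ⊢
  obtain ⟨E₀, hE₀, q, N, c, hN, hchn, hchp⟩ := hD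
  have hti : ∀ i : ℕ, ((t ^ i : ℚ) : ℂ) ≠ 0 := fun i => by exact_mod_cast pow_ne_zero i ht
  have key : ∀ i : ℕ, C₀.ch P.X E₀ i = (((t ^ i)⁻¹ : ℚ) : ℂ) • C.ch P.X E₀ i := by
    intro i
    rw [hCC₀ E₀ hE₀ i, smul_smul, Rat.cast_inv, inv_mul_cancel₀ (hti i), one_smul]
  refine ⟨E₀, hE₀, (t ^ n)⁻¹ * q, (t ^ n)⁻¹ * N, fun i => (t ^ i)⁻¹ * c i,
    mul_ne_zero (inv_ne_zero (pow_ne_zero n ht)) hN, ?_, fun p hp hpn => ?_⟩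
  · rw [key n, hchn, smul_add, smul_smul, smul_smul, ← Rat.cast_mul, ← Rat.cast_mul]
  · rw [key p, hchp p hp hpn, smul_smul, ← Rat.cast_mul]

/-- **`C₀`-seeds are `C`-seeds** when `C.chᵢ = tⁱ·C₀.chᵢ` on the finite locally free modules of `P.X`: multiply the
coefficients by `tⁱ` (`N ≠ 0` is kept as `t ≠ 0`); the `I`-semiregularity clause does not involve `C`.
[cite: BuchweitzFlenner2003, §5 (I-semiregular)] [cite: Fulton1998, Example 3.2.3] -/
theorem hasBFSheafSeedAt_of_scaling (ht : t ≠ 0)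
    (hCC₀ : ∀ (E : P.X.left.Modules), IsFiniteLocallyFree E → ∀ i : ℕ,
      C.ch P.X E i = ((t ^ i : ℚ) : ℂ) • C₀.ch P.X E i)
    (hS : HasBFSheafSeedAt C₀ n P h w) : HasBFSheafSeedAt C n P h w := by
  rw [hasBFSheafSeedAt_iff_exists_on] at hS ⊢
  obtain ⟨I, E₀, hE₀, q, N, c, hnI, hN, hsr, hchn, hchp⟩ := hS
  refine ⟨I, E₀, hE₀, t ^ n * q, t ^ n * N, fun i => t ^ i * c i, hnI, mul_ne_zero (pow_ne_zero n ht) hN, hsr,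
    ?_, fun p' hp' hpn => ?_⟩
  · rw [hCC₀ E₀ hE₀ n, hchn, smul_add, smul_smul, smul_smul, ← Rat.cast_mul, ← Rat.cast_mul]
  · rw [hCC₀ E₀ hE₀ p', hchp p' hp' hpn, smul_smul, ← Rat.cast_mul]

/-- **The K2 upgrade transfers along a scaling relation**: `C.chᵢ = tⁱ·C₀.chᵢ` on the finite locally free modules of
`P.X` and `HasWeilClassDesignAt C₀ n P h w → HasBFSheafSeedAt C₀ n P h w` give
`HasWeilClassDesignAt C n P h w → HasBFSheafSeedAt C n P h w`. [cite: BuchweitzFlenner2003, §5 (I-semiregular)]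
[cite: Fulton1998, Example 3.2.3] -/
theorem upgrade_of_scaling (ht : t ≠ 0)
    (hCC₀ : ∀ (E : P.X.left.Modules), IsFiniteLocallyFree E → ∀ i : ℕ,
      C.ch P.X E i = ((t ^ i : ℚ) : ℂ) • C₀.ch P.X E i)
    (hup₀ : HasWeilClassDesignAt C₀ n P h w → HasBFSheafSeedAt C₀ n P h w) :
    HasWeilClassDesignAt C n P h w → HasBFSheafSeedAt C n P h w :=
  fun hD => hasBFSheafSeedAt_of_scaling ht hCC₀ (hup₀ (hasWeilClassDesignAt_of_scaling ht hCC₀ hD))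

end Scaling

/-! ### §2 Sanity: invariance of the K2 predicates under the rescaling freedom `chᵢ ↦ tⁱ·chᵢ` -/

section Rescale

variable (C : ChernCharacterBetti) {n : ℕ} {P : AbelianVariety ℂ} {h : complexBetti P.X 2}
  {w : complexBetti P.X (2 * n)} (t : ℚ) (ht : t ≠ 0)

/-- `HasWeilClassDesignAt` is invariant under rescaling the theory. [cite: Fulton1998, Example 3.2.3] -/
theorem hasWeilClassDesignAt_rescale_iff :
    HasWeilClassDesignAt (C.rescale t ht) n P h w ↔ HasWeilClassDesignAt C n P h w := by
  refine ⟨hasWeilClassDesignAt_of_scaling (C := C.rescale t ht) (C₀ := C) ht fun E _ i => ?_, fun hD => ?_⟩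
  · exact ChernCharacterBetti.rescale_ch C t ht P.X E i
  · have ht' : t⁻¹ ≠ 0 := inv_ne_zero ht
    refine hasWeilClassDesignAt_of_scaling (C := C) (C₀ := C.rescale t ht) ht' (fun E _ i => ?_) hD
    rw [ChernCharacterBetti.rescale_ch, smul_smul, ← Rat.cast_mul, inv_pow, inv_mul_cancel₀ (pow_ne_zero i ht),
      Rat.cast_one, one_smul]

/-- `HasBFSheafSeedAt` is invariant under rescaling the theory. [cite: BuchweitzFlenner2003, §5 (I-semiregular)] -/
theorem hasBFSheafSeedAt_rescale_iff :
    HasBFSheafSeedAt (C.rescale t ht) n P h w ↔ HasBFSheafSeedAt C n P h w := by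
  refine ⟨fun hS => ?_, hasBFSheafSeedAt_of_scaling (C := C.rescale t ht) (C₀ := C) ht fun E _ i => ?_⟩
  · have ht' : t⁻¹ ≠ 0 := inv_ne_zero ht
    refine hasBFSheafSeedAt_of_scaling (C := C) (C₀ := C.rescale t ht) ht' (fun E _ i => ?_) hS
    rw [ChernCharacterBetti.rescale_ch, smul_smul, ← Rat.cast_mul, inv_pow, inv_mul_cancel₀ (pow_ne_zero i ht),
      Rat.cast_one, one_smul]
  · exact ChernCharacterBetti.rescale_ch C t ht P.X E i

/-- **The K2 upgrade at an anchor is invariant under the rescaling freedom of `ChernCharacterBetti`.**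
[cite: Fulton1998, Example 3.2.3] [cite: BuchweitzFlenner2003, §5 (I-semiregular)] -/
theorem upgrade_rescale_iff :
    (HasWeilClassDesignAt (C.rescale t ht) n P h w → HasBFSheafSeedAt (C.rescale t ht) n P h w) ↔
      (HasWeilClassDesignAt C n P h w → HasBFSheafSeedAt C n P h w) := by
  rw [hasWeilClassDesignAt_rescale_iff, hasBFSheafSeedAt_rescale_iff]

end Rescale

/-! ### §3 K2 for all theories from K2 for one theory, under uniqueness up to scaling on the anchors -/

/-- **K2 ⇐ (U) + good anchors for ONE theory.** Let `C₀` be a Chern character theory with one good anchor per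
discriminant class — for every `d ≥ 1` and every class `δ ∈ ℚˣ/Nm(ℚ(√-d)ˣ)` of sign `(-1)³` other than the split class,
a `(3, d)` anchor `(P, ψ₀, e, e', a, a', w)` of class `δ` (hyperbolic at `h(e', a')`, `w` a non-zero rational `(3,3)`
Weil class) at which `HasWeilClassDesignAt C₀ → HasBFSheafSeedAt C₀` — and suppose (U): every theory `C` agrees with
`C₀` up to the scaling `chᵢ ↦ tⁱ·chᵢ` (`t ∈ ℚˣ`, depending on `C` and the anchor) on the finite locally free modules of
every abelian sixfold. Then `KleimanSemiregularAnchor`: the upgrade transfers from `C₀` to `C` (§1) at the SAME anchor,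
and the landed Landherr bookkeeping `kleimanSemiregularAnchor_of_goodAnchor_in_each_discriminantClass` concludes.
[cite: vanGeemen1994HodgeAV, Lemma 5.2 (3)–(4) and 5.3–5.4] [cite: Fulton1998, Example 3.2.3]
[cite: BuchweitzFlenner2003, §5 (I-semiregular)] -/
theorem kleimanSemiregularAnchor_of_goodAnchors_for_one_theory (C₀ : ChernCharacterBetti)
    (hU : ∀ (C : ChernCharacterBetti) (P : AbelianVariety ℂ), P.dim = 2 * 3 →
      ∃ t : ℚ, t ≠ 0 ∧ ∀ (E : P.X.left.Modules), IsFiniteLocallyFree E → ∀ i : ℕ,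
        C.ch P.X E i = ((t ^ i : ℚ) : ℂ) • C₀.ch P.X E i)
    (hgood₀ : ∀ (d : ℕ) (δ : weilNormResidueGroup d), 0 < d →
      weilSign d δ = (-1) ^ 3 → δ ≠ QuotientGroup.mk ((-1 : ℚˣ) ^ 3) →
      ∃ (P : AbelianVariety ℂ) (ψ₀ : P ⟶ P) (e e' : ProjectiveEmbedding P.X)
        (a : complexBetti (projectiveSpace e.n ℂ) 2) (a' : complexBetti (projectiveSpace e'.n ℂ) 2)
        (w : complexBetti P.X (2 * 3)),
        P.dim = 2 * 3 ∧ ψ₀ ≫ ψ₀ = -(d • 𝟙 P) ∧ IsRationalClass a ∧ a ≠ 0 ∧ IsRationalClass a' ∧ a' ≠ 0 ∧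
        w ∈ weilClassesOf P ψ₀ 3 d ∧ IsRationalClass w ∧ w ≠ 0 ∧ IsOfHodgeType (2 * 3) P.X (2 * 3) 3 3 w ∧
        IsHyperbolicWeilType P ψ₀ 3
          ((d : ℂ) • complexBetti.map e'.ι 2 a' + complexBetti.map ψ₀.hom.hom.hom 2 (complexBetti.map e'.ι 2 a')) ∧
        HasWeilDiscriminantNondeg P ψ₀ 3 d
          ((d : ℂ) • complexBetti.map e.ι 2 a + complexBetti.map ψ₀.hom.hom.hom 2 (complexBetti.map e.ι 2 a)) δ ∧
        (HasWeilClassDesignAt C₀ 3 P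
            ((d : ℂ) • complexBetti.map e.ι 2 a + complexBetti.map ψ₀.hom.hom.hom 2 (complexBetti.map e.ι 2 a)) w →
          HasBFSheafSeedAt C₀ 3 P
            ((d : ℂ) • complexBetti.map e.ι 2 a + complexBetti.map ψ₀.hom.hom.hom 2 (complexBetti.map e.ι 2 a)) w)) :
    Summit.HodgeConjecture.HodgeConjecture.Theses.KleimanBFSeeds.KleimanSemiregularAnchor := by
  refine kleimanSemiregularAnchor_of_goodAnchor_in_each_discriminantClass fun C d δ hd hsign hne => ?_
  obtain ⟨P, ψ₀, e, e', a, a', w, hP, hψ, ha, ha0, ha', ha'0, hwW, hwrat, hw0, hwH, hhyp, hN, hup₀⟩ :=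
    hgood₀ d δ hd hsign hne
  obtain ⟨t, ht, hCC₀⟩ := hU C P hP
  exact ⟨P, ψ₀, e, e', a, a', w, hP, hψ, ha, ha0, ha', ha'0, hwW, hwrat, hw0, hwH, hhyp, hN,
    upgrade_of_scaling ht hCC₀ hup₀⟩

end Summit.HodgeConjecture.HodgeConjecture.Theorems

end
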